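import Summits.QuantumAdvantage.QuantumAdvantage.Theorems.CharDialCountDialA
import HarnessLib

/-!
# CharDial ▸ CountDial, part E — the census record `f58` is a REAL CUBIC: degree ≤ 3 over every field, rainbow on 9 coordinates, leaf constant ≥ 9

Part E of «CountDial» (NODE-g24.md §6): the census record `f58` (K54 `census/data/cubicmod3-v1/reps/f58_n9.txt`: m = 9, 58 rows,
9 exchangeability classes, stabiliser 192) has integer multilinear polynomial `pz9` — 32 monomials with coefficients ±1, degree 3 — so
★ `indicator_f58_mem (F) [Field F] : 1_{f58} ∈ lowDeg F 9 3` over EVERY field, ★ `hasDegF_f58 : HasDegF p f58 3` for every prime, and f58 is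
RAINBOW (★ `f58_rainbow`, 36 explicit swap witnesses checked by `decide`), whence ★ `nine_le_of_fewTypesTwoOdd_at`: the leaf's constant is `≥ 9`
at every prime `p ≥ 5`.  (Census K57 confirms f58 real-cubic independently and the only real-cubic orbit above rowCount 32 at m ≤ 10.)

Kernel standard: no placeholders; axioms [propext, Classical.choice, Quot.sound] only (guards at the end); closed computations by kernel `decide`.
-/

set_option autoImplicit false
set_option linter.dupNamespace false

namespace Summit.QuantumAdvantage.QuantumAdvantage.Theorems.CountDial

open Classical
open Finset
open Summit.QuantumAdvantage.AdviceFreeQNC0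
open Literature.Computability.MetaComplexity Literature.Computability.MetaComplexity.Smolensky
open Summit.QuantumAdvantage.QuantumAdvantage.Theorems.TransferDial

/-! ## §8 The census extremiser `f58` is a REAL CUBIC (kernel certificate)

`f58` (m = 9; K54 `census/data/cubicmod3-v1/reps/f58_n9.txt`: 58 rows, 9 exchangeability classes, stabiliser of order 192) is the
Boolean function whose ±1/0 integer multilinear polynomial is `pz9` below (32 monomials, degree 3).  Hence `deg_F f58 ≤ 3` over EVERY
field (`indicator_f58_mem`), in particular `HasDegF p f58 3` for every prime and `ℚ`-degree 3: by Nisan–Szegedy (§10) it belongs to the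
FINITE family of real-degree-3 Boolean functions — sporadic, not the head of an infinite family.  It is RAINBOW (all 9 coordinates
pairwise non-exchangeable, `f58_rainbow`, 36 explicit witnesses), so the leaf's constant is `≥ 9` at every prime (`nine_le_of_fewTypesAt`). -/

section F58

/-- The integer multilinear polynomial of `f58` over any commutative ring (coefficients in {0, ±1}, degree 3, 32 terms). -/
def pz9 (R : Type*) [CommRing R] (x0 x1 x2 x3 x4 x5 x6 x7 x8 : R) : R :=
  1 - x4 - x5 - x8 - x1 * x3 + x1 * x4 - x1 * x7 + x1 * x8 - x2 * x3 + x2 * x8 + x3 * x4 + x3 * x5 + x4 * x5 + x4 * x8 + x5 * x7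
    + x5 * x8 - x0 * x1 * x4 + x0 * x1 * x7 + x0 * x2 * x5 - x0 * x2 * x6 + x0 * x4 * x6 - x0 * x5 * x7 + x1 * x2 * x3 - x1 * x2 * x8
    + x1 * x3 * x7 - x1 * x4 * x8 + x2 * x3 * x6 - x2 * x5 * x8 - x3 * x4 * x5 - x3 * x4 * x6 - x3 * x5 * x7 - x4 * x5 * x8

/-- `{0,1} ⊆ ℤ` embedding of a bit. -/
def bz (b : Bool) : ℤ := if b = true then 1 else 0

/-- The polynomial takes only the values 0 and 1 on the cube (kernel, 512 cases). -/
theorem pz9_boolean : ∀ b0 b1 b2 b3 b4 b5 b6 b7 b8 : Bool,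
    pz9 ℤ (bz b0) (bz b1) (bz b2) (bz b3) (bz b4) (bz b5) (bz b6) (bz b7) (bz b8) = 0 ∨
      pz9 ℤ (bz b0) (bz b1) (bz b2) (bz b3) (bz b4) (bz b5) (bz b6) (bz b7) (bz b8) = 1 := by
  decide

/-- ★ `f58`: the Boolean function on 9 bits cut out by `pz9` (= the K54 census representative, truth table `u ↦ Σ uᵢ2ⁱ`). -/
def f58 (u : Fin 9 → Bool) : Bool :=
  decide (pz9 ℤ (bz (u 0)) (bz (u 1)) (bz (u 2)) (bz (u 3)) (bz (u 4)) (bz (u 5)) (bz (u 6)) (bz (u 7)) (bz (u 8)) = 1)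

/-- The monomial list of `pz9` (coefficient, variables). -/
def L58 : List (ℤ × List (Fin 9)) :=
  [(1, []), (-1, [4]), (-1, [5]), (-1, [8]), (-1, [1, 3]), (1, [1, 4]), (-1, [1, 7]), (1, [1, 8]), (-1, [2, 3]), (1, [2, 8]),
   (1, [3, 4]), (1, [3, 5]), (1, [4, 5]), (1, [4, 8]), (1, [5, 7]), (1, [5, 8]), (-1, [0, 1, 4]), (1, [0, 1, 7]), (1, [0, 2, 5]),
   (-1, [0, 2, 6]), (1, [0, 4, 6]), (-1, [0, 5, 7]), (1, [1, 2, 3]), (-1, [1, 2, 8]), (1, [1, 3, 7]), (-1, [1, 4, 8]), (1, [2, 3, 6]),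
   (-1, [2, 5, 8]), (-1, [3, 4, 5]), (-1, [3, 4, 6]), (-1, [3, 5, 7]), (-1, [4, 5, 8])]

/-- Every monomial of `L58` has `≤ 3` variables. -/
theorem L58_deg : ∀ t ∈ L58, t.2.length ≤ 3 := by decide

variable (F : Type*) [Field F]

/-- The cube function `u ↦ Π_{i ∈ l} [uᵢ]` of a variable list. -/
def prodFn {n : ℕ} (l : List (Fin n)) : CubeFn F n := fun u => (l.map fun i => if u i = true then (1 : F) else 0).prod

/-- The cube function of a monomial list `Σ c · Π_{i ∈ l} [uᵢ]`. -/
def polyFn {n : ℕ} (L : List (ℤ × List (Fin n))) : CubeFn F n := fun u => (L.map fun t => (t.1 : F) * prodFn F t.2 u).sum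

/-- A product of `≤ d` coordinate indicators lies in `lowDeg F n d`. -/
theorem prodFn_mem {n : ℕ} (l : List (Fin n)) : prodFn F l ∈ lowDeg F n l.length := by
  induction l with
  | nil =>
      have e : prodFn F ([] : List (Fin n)) = 1 := by
        funext u
        simp [prodFn]
      rw [e]
      exact one_mem_lowDeg 0
  | cons i l ih =>
      have e : prodFn F (i :: l) = mono F ({i} : Finset (Fin n)) * prodFn F l := by
        funext u
        simp [prodFn, mono]
      rw [e, List.length_cons, Nat.add_comm]
      exact mul_mem_lowDeg_add (mono_mem_lowDeg (by simp)) ih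

/-- The function of a monomial list with monomials of size `≤ d` lies in `lowDeg F n d`. -/
theorem polyFn_mem {n d : ℕ} (L : List (ℤ × List (Fin n))) (hL : ∀ t ∈ L, t.2.length ≤ d) : polyFn F L ∈ lowDeg F n d := by
  induction L with
  | nil =>
      have e : polyFn F ([] : List (ℤ × List (Fin n))) = 0 := by
        funext u
        simp [polyFn]
      rw [e]
      exact Submodule.zero_mem _
  | cons t L ih =>
      have e : polyFn F (t :: L) = (t.1 : F) • prodFn F t.2 + polyFn F L := by
        funext u
        simp [polyFn, smul_eq_mul]
      rw [e]
      exact Submodule.add_mem _ (Submodule.smul_mem _ _ (lowDeg_mono (hL t (by simp)) (prodFn_mem F t.2)))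
        (ih fun t' ht' => hL t' (by simp [ht']))

/-- The monomial list evaluates to the polynomial (over any field). -/
theorem polyFn_L58 (u : Fin 9 → Bool) :
    polyFn F L58 u = pz9 F (if u 0 = true then 1 else 0) (if u 1 = true then 1 else 0) (if u 2 = true then 1 else 0)
      (if u 3 = true then 1 else 0) (if u 4 = true then 1 else 0) (if u 5 = true then 1 else 0) (if u 6 = true then 1 else 0)
      (if u 7 = true then 1 else 0) (if u 8 = true then 1 else 0) := by
  simp only [polyFn, prodFn, L58, pz9, List.map_cons, List.map_nil, List.prod_cons, List.prod_nil, List.sum_cons, List.sum_nil,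
    Int.cast_one, Int.cast_neg]
  ring

/-- Casting the integer polynomial into `F`. -/
theorem pz9_cast (b0 b1 b2 b3 b4 b5 b6 b7 b8 : Bool) :
    ((pz9 ℤ (bz b0) (bz b1) (bz b2) (bz b3) (bz b4) (bz b5) (bz b6) (bz b7) (bz b8) : ℤ) : F) =
      pz9 F (if b0 = true then 1 else 0) (if b1 = true then 1 else 0) (if b2 = true then 1 else 0) (if b3 = true then 1 else 0)
        (if b4 = true then 1 else 0) (if b5 = true then 1 else 0) (if b6 = true then 1 else 0) (if b7 = true then 1 else 0)
        (if b8 = true then 1 else 0) := by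
  simp only [pz9, bz]
  push_cast
  ring

/-- ★ The indicator of `f58` IS the polynomial `pz9` on the cube, over every field. -/
theorem indicator_f58_eq : (fun u => if f58 u then (1 : F) else 0) = polyFn F L58 := by
  funext u
  rw [polyFn_L58, ← pz9_cast]
  rcases pz9_boolean (u 0) (u 1) (u 2) (u 3) (u 4) (u 5) (u 6) (u 7) (u 8) with h | h
  · simp [f58, h]
  · simp [f58, h]

/-- ★ KERNEL CERTIFICATE: `deg_F f58 ≤ 3` over every field `F`. -/
theorem indicator_f58_mem : (fun u => if f58 u then (1 : F) else 0) ∈ lowDeg F 9 3 := by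
  rw [indicator_f58_eq]
  exact polyFn_mem F L58 L58_deg

/-- In particular `HasDegF p f58 3` for EVERY prime `p` (so `f58 ∈ B_{2p−3}(9)` for all `p ≥ 3`). -/
theorem hasDegF_f58 (p : ℕ) [Fact p.Prime] : HasDegF p f58 3 := indicator_f58_mem (ZMod p)

/-- The 36 (·2) rainbow witnesses, flat table: entry `9i + j` encodes `u` with `f58 (u ∘ swap i j) ≠ f58 u` (bit `k` = `u k`). -/
def witTab : List ℕ :=
  [0, 9, 9, 3, 1, 1, 13, 3, 1, 9, 0, 18, 6, 2, 2, 7, 10, 2, 9, 18, 0, 6, 4, 4, 12, 6, 4, 3, 6, 6, 0, 8, 8, 10, 11, 8, 1, 2, 4, 8, 0, 18,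
   16, 16, 19, 1, 2, 4, 8, 18, 0, 32, 32, 34, 13, 7, 12, 10, 16, 32, 0, 66, 64, 3, 10, 6, 11, 16, 32, 66, 0, 128, 1, 2, 4, 8, 19, 34,
   64, 128, 0]

/-- The witness word for the pair `(i, j)`. -/
def wit (i j : Fin 9) : Fin 9 → Bool := fun k => Nat.testBit (witTab.getD (i.val * 9 + j.val) 0) k.val

/-- Kernel check of the 72 ordered pairs. -/
theorem f58_wit : ∀ i j : Fin 9, i ≠ j → f58 (wit i j ∘ Equiv.swap i j) ≠ f58 (wit i j) := by decide

/-- ★ `f58` is RAINBOW: its 9 coordinates are pairwise non-exchangeable (9 exchangeability classes on 9 bits at degree 3). -/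
theorem f58_rainbow : Rainbow f58 univ := fun i _ j _ hij hs => f58_wit i j hij (hs (wit i j))

/-- ★ Consequently the leaf's constant is at least 9 at EVERY prime: `FewTypesAt p d N` with `d ≥ 3` forces `N ≥ 9` (pigeonhole on a
colouring of the rainbow `f58`). -/
theorem nine_le_of_fewTypesAt (p : ℕ) [Fact p.Prime] {d N : ℕ} (hd : 3 ≤ d) (hF : FewTypesAt p d N) : 9 ≤ N := by
  by_contra hN
  obtain ⟨c, hc⟩ := fewTypesAt_mono hd hF 9 f58 (hasDegF_f58 p)
  obtain ⟨i, j, hij, hcij⟩ := Fintype.exists_ne_map_eq_of_card_lt c (by simp; omega)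
  exact f58_rainbow i (mem_univ _) j (mem_univ _) hij (hc i j hcij)

/-- … in particular for the leaf `FewTypesTwoOdd` (degree `2p − 3 ≥ 7`). -/
theorem nine_le_of_fewTypesTwoOdd_at (p : ℕ) [Fact p.Prime] (hp : 5 ≤ p) {N : ℕ} (hF : FewTypesAt p (2 * p - 3) N) : 9 ≤ N :=
  nine_le_of_fewTypesAt p (by omega) hF

end F58

/-! ### Axiom guards -/

/-- info: 'Summit.QuantumAdvantage.QuantumAdvantage.Theorems.CountDial.hasDegF_f58' depends on axioms: [propext,
 choice,
 Quot.sound] -/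
#guard_msgs in #print axioms hasDegF_f58

/-- info: 'Summit.QuantumAdvantage.QuantumAdvantage.Theorems.CountDial.f58_rainbow' depends on axioms: [propext,
 choice,
 Quot.sound] -/
#guard_msgs in #print axioms f58_rainbow

/-- info: 'Summit.QuantumAdvantage.QuantumAdvantage.Theorems.CountDial.nine_le_of_fewTypesTwoOdd_at' depends on axioms: [propext,
 choice,
 Quot.sound] -/
#guard_msgs in #print axioms nine_le_of_fewTypesTwoOdd_at

end Summit.QuantumAdvantage.QuantumAdvantage.Theorems.CountDial
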